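import Literature.NumberTheory.EllipticCurves.FormalGroupLubinTateDivisionPointsTateUnitUnique
import Literature.NumberTheory.EllipticCurves.CMFormalActionLaneCoherence
import HarnessLib

/-!
# The Tate-module unit of the division points does not depend on the coefficient field: B10a's point property is stable under
# enlarging `E ≤ E′`, and units serving the same `F̄`-points over `E` and over `E′` coincide (de Shalit II §4.3–4.4 — proofs only)

Topic `NumberTheory/EllipticCurves` (theorems only; no definition, no named fact, no instance).  Cell `bsd-print-cf2`, width seat
`bsd-line-cf2-p1-w2` g25, piece U4 (asked by the seam assembler: the per-label bridges of de Shalit's class sum read their theta data in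
DIFFERENT finite unramified coefficient fields `E_{k,i} ⊇ E_k`; the Tate unit produced over each must be the level's one).  For the lane
datum (`e : 𝒪[F] ≃+* ℤ_p`, `P ∈ 𝔉_{π_ℤ}`, `e π = π_ℤ`, lane curve `V ⊗ LTCoeff F`, `h = [1]_{P′,f}`):

* ★ `forall_ptOfZ_hom_hom_cohPt_eq_of_le` — if `a ∈ 𝒪_F` serves points `(X_n, Y_n) ∈ E₁(E·K_π^{n+1})`, i.e. `P(h([a]_f ω_{n+1})) = (X_n, Y_n)`
  for all `n`, then over any finite `E′ ⊇ E` it serves the SAME points read in `E′·K_π^{n+1}` — the parameter `h([a]_f ω_{n+1})` is natural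
  along the inclusion (`inclUnitBall_ltSMul`, `algHom_evalPt₁_hom`), and so is `z = −x/y` (`zPt_some_eq_inclPt_zPt_some`, `‖ι x‖ = ‖x‖`);
* ★ `unit_eq_of_forall_ptOfZ_hom_hom_cohPt_eq_of_le` — if `a` serves `(X_n, Y_n)` over `E` and `b` serves `(X′_n, Y′_n) = (ι X_n, ι Y_n)`
  over `E′ ⊇ E`, then `a = b` (the above + `unit_eq_of_forall_ptOfZ_hom_hom_cohPt_eq` over `E′`).

KERNEL NOTE: both statements take the enlarged coordinates `X′_n` with `ι X_n = X′_n` as EQUATIONS in `E′·K_π^{n+1}` (for `X′_n := ι X_n`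
this is `rfl`); deriving them from equal `F̄`-coordinates by `Subtype.ext` inside this file makes the KERNEL time out on the
`IntermediateField.inclusion` coercion at these tower types — callers should define the enlarged points as inclusions.

No summit statement is proved; BSD is not proved by any of this.

## References
* [deShalit1987] E. de Shalit, *Iwasawa theory of elliptic curves with complex multiplication* (1987), II §4.3 (p. 57: «`Ω_p` is uniquely
  determined modulo `𝒪_𝔭ˣ`»), II §4.4 (11)–(12), (iii)–(iv).
* [SilvermanAEC2009] J. H. Silverman, *The Arithmetic of Elliptic Curves*, 2nd ed. (2009), VII.2.2.
-/

noncomputable section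

open scoped Classical
open PowerSeries

namespace Literature.NumberTheory.EllipticCurves

open ValuativeRel Literature.NumberTheory.GaloisRepresentations
  Literature.NumberTheory.GaloisRepresentations.IsNonarchimedeanLocalField
  Literature.NumberTheory.GaloisRepresentations.LubinTate
open Literature.NumberTheory.EllipticCurves.FormalGroupChart _root_.WeierstrassCurve

section TateUnitEnlarge

variable {F : Type} [Field F] [ValuativeRel F] [TopologicalSpace F] [IsNonarchimedeanLocalField F]

attribute [local instance] ltNormUniformSpace ltNormIsUniformAddGroup rk1 nF nE fintypeResidueField

variable {p : ℕ} [Fact p.Prime] (e : 𝒪[F] ≃+* ℤ_[p]) (hq : residueFieldCard F = p)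
  {π : 𝒪[F]} (hπ : (valuation F).IsUniformizer (π : F)) {πZ : ℤ_[p]} (he : e π = πZ)
  {P : PowerSeries ℤ_[p]} (hP : IsLTSeries πZ p P) (V : WeierstrassCurve ℤ_[p])
  (E E' : IntermediateField F (AlgebraicClosure F)) [FiniteDimensional F E] [FiniteDimensional F E']

set_option maxHeartbeats 800000 in
/-- ★ **B10a's point property is stable under enlarging the coefficient field** (`E ≤ E′`): if `P(h([a]_f ω_{n+1})) = (X_n, Y_n)` on the
lane curve over `E·K_π^{n+1}` for all `n`, then `P(h([a]_f ω_{n+1})) = (X′_n, Y′_n)` over `E′·K_π^{n+1}` for every nonsingular `(X′_n, Y′_n)`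
with `ι X_n = X′_n`, `ι Y_n = Y′_n` (`ι` the inclusion) — stated with target coordinates so that no cast enters.
The parameter is natural along the continuous inclusion of unit balls and so is `z = −x/y`; `P` is injective on parameters.
[cite: deShalit1987, II §4.4 (11)–(12), (iv)] [cite: SilvermanAEC2009, VII.2.2] -/
theorem forall_ptOfZ_hom_hom_cohPt_eq_of_le
    [hEll : ∀ n : ℕ, (curveOver (E ⊔ ltField π n : IntermediateField F (AlgebraicClosure F))
      (V.map ((LTCoeff.of F).toRingHom.comp e.symm.toRingHom))).IsElliptic]
    [hEll' : ∀ n : ℕ, (curveOver (E' ⊔ ltField π n : IntermediateField F (AlgebraicClosure F))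
      (V.map ((LTCoeff.of F).toRingHom.comp e.symm.toRingHom))).IsElliptic]
    (hEE' : E ≤ E')
    (X Y : ∀ n : ℕ, ↥(E ⊔ ltField π n : IntermediateField F (AlgebraicClosure F)))
    (hXY : ∀ n : ℕ, (curveOver (E ⊔ ltField π n : IntermediateField F (AlgebraicClosure F))
      (V.map ((LTCoeff.of F).toRingHom.comp e.symm.toRingHom))).toAffine.Nonsingular (X n) (Y n))
    {a : 𝒪[F]}
    (ha : ∀ n : ℕ,
      ptOfZ (E ⊔ ltField π n : IntermediateField F (AlgebraicClosure F)) (V.map ((LTCoeff.of F).toRingHom.comp e.symm.toRingHom))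
        (evalPt₁ (maxNilIdeal F (E ⊔ ltField π n : IntermediateField F (AlgebraicClosure F)))
          (hom (isLTRing_LTCoeff hπ) (isLTSeries_map_LTCoeff_of_degree_one e hq he hP) (isLTSeries_LTCoeff π) 1)
          (constantCoeff_hom _ _ _ 1)
          (evalPt₁ (maxNilIdeal F (E ⊔ ltField π n : IntermediateField F (AlgebraicClosure F)))
            (hom (isLTRing_LTCoeff hπ) (isLTSeries_LTCoeff π) (isLTSeries_LTCoeff π) (LTCoeff.of F a))
            (constantCoeff_hom _ _ _ _)
            (inclPt (le_sup_right : ltField π n ≤ E ⊔ ltField π n) (cohPt hπ n)))) = .some (X n) (Y n) (hXY n)) :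
    ∀ (n : ℕ) (X' Y' : ↥(E' ⊔ ltField π n : IntermediateField F (AlgebraicClosure F)))
      (_hx : IntermediateField.inclusion (sup_le_sup_right hEE' (ltField π n)) (X n) = X')
      (_hy : IntermediateField.inclusion (sup_le_sup_right hEE' (ltField π n)) (Y n) = Y')
      (h' : (curveOver (E' ⊔ ltField π n : IntermediateField F (AlgebraicClosure F))
        (V.map ((LTCoeff.of F).toRingHom.comp e.symm.toRingHom))).toAffine.Nonsingular X' Y'),
      ptOfZ (E' ⊔ ltField π n : IntermediateField F (AlgebraicClosure F)) (V.map ((LTCoeff.of F).toRingHom.comp e.symm.toRingHom))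
        (evalPt₁ (maxNilIdeal F (E' ⊔ ltField π n : IntermediateField F (AlgebraicClosure F)))
          (hom (isLTRing_LTCoeff hπ) (isLTSeries_map_LTCoeff_of_degree_one e hq he hP) (isLTSeries_LTCoeff π) 1)
          (constantCoeff_hom _ _ _ 1)
          (evalPt₁ (maxNilIdeal F (E' ⊔ ltField π n : IntermediateField F (AlgebraicClosure F)))
            (hom (isLTRing_LTCoeff hπ) (isLTSeries_LTCoeff π) (isLTSeries_LTCoeff π) (LTCoeff.of F a))
            (constantCoeff_hom _ _ _ _)
            (inclPt (le_sup_right : ltField π n ≤ E' ⊔ ltField π n) (cohPt hπ n)))) = .some X' Y' h' := by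
  have hP' := isLTSeries_map_LTCoeff_of_degree_one e hq he hP
  intro n X' Y' hx hy h'
  subst hx hy
  have hn : (E ⊔ ltField π n : IntermediateField F (AlgebraicClosure F)) ≤ E' ⊔ ltField π n := sup_le_sup_right hEE' _
  -- kernel memberships of the point and of its inclusion
  have hker : (.some (X n) (Y n) (hXY n) : (curveOver (E ⊔ ltField π n : IntermediateField F (AlgebraicClosure F))
      (V.map ((LTCoeff.of F).toRingHom.comp e.symm.toRingHom))).toAffine.Point) ∈
      kernel (NormedField.valuation (K := (E ⊔ ltField π n : IntermediateField F (AlgebraicClosure F))))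
        (curveOver (E ⊔ ltField π n : IntermediateField F (AlgebraicClosure F)) (V.map ((LTCoeff.of F).toRingHom.comp e.symm.toRingHom))) := by
    rw [← ha n]; exact ptOfZ_mem_kernel _
  have hker' : (.some _ _ h' : (curveOver (E' ⊔ ltField π n : IntermediateField F (AlgebraicClosure F))
      (V.map ((LTCoeff.of F).toRingHom.comp e.symm.toRingHom))).toAffine.Point) ∈
      kernel (NormedField.valuation (K := (E' ⊔ ltField π n : IntermediateField F (AlgebraicClosure F))))
        (curveOver (E' ⊔ ltField π n : IntermediateField F (AlgebraicClosure F)) (V.map ((LTCoeff.of F).toRingHom.comp e.symm.toRingHom))) := by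
    -- `‖ι x‖ = ‖x‖` (as in `DivisionPointsLaneCoherence.some_inclusion_mem_kernel`)
    have hk : (.some (X n) (Y n) (hXY n) : (curveOver (E ⊔ ltField π n : IntermediateField F (AlgebraicClosure F))
        (V.map ((LTCoeff.of F).toRingHom.comp e.symm.toRingHom))).toAffine.Point) ∈
        kernel (NormedField.valuation (K := (E ⊔ ltField π n : IntermediateField F (AlgebraicClosure F))))
          (curveOver (E ⊔ ltField π n : IntermediateField F (AlgebraicClosure F))
            (V.map ((LTCoeff.of F).toRingHom.comp e.symm.toRingHom))) := hker
    rw [some_mem_kernel_iff] at hk ⊢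
    rw [← NNReal.coe_lt_coe, NormedField.valuation_apply, coe_nnnorm, NNReal.coe_one] at hk ⊢
    rwa [norm_inclusion]
  -- the `[a]_f`-part of the parameter is natural along the inclusion
  have h1 : inclPt hn (evalPt₁ (maxNilIdeal F (E ⊔ ltField π n : IntermediateField F (AlgebraicClosure F)))
      (hom (isLTRing_LTCoeff hπ) (isLTSeries_LTCoeff π) (isLTSeries_LTCoeff π) (LTCoeff.of F a)) (constantCoeff_hom _ _ _ _)
      (inclPt (le_sup_right : ltField π n ≤ E ⊔ ltField π n) (cohPt hπ n))) =
      evalPt₁ (maxNilIdeal F (E' ⊔ ltField π n : IntermediateField F (AlgebraicClosure F)))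
        (hom (isLTRing_LTCoeff hπ) (isLTSeries_LTCoeff π) (isLTSeries_LTCoeff π) (LTCoeff.of F a)) (constantCoeff_hom _ _ _ _)
        (inclPt (le_sup_right : ltField π n ≤ E' ⊔ ltField π n) (cohPt hπ n)) := by
    apply Subtype.ext
    have e1 := inclUnitBall_ltSMul hn (hA := isLTRing_LTCoeff hπ) (LTCoeff.of F a)
      (inclPt (le_sup_right : ltField π n ≤ E ⊔ ltField π n) (cohPt hπ n))
    have e2 : inclPt hn (inclPt (le_sup_right : ltField π n ≤ E ⊔ ltField π n) (cohPt hπ n)) =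
        inclPt (le_sup_right : ltField π n ≤ E' ⊔ ltField π n) (cohPt hπ n) := pt_ext rfl
    rw [e2] at e1
    exact e1
  -- hence so is the whole parameter `h([a]_f ω')`
  have h2 : inclPt hn (evalPt₁ (maxNilIdeal F (E ⊔ ltField π n : IntermediateField F (AlgebraicClosure F)))
      (hom (isLTRing_LTCoeff hπ) hP' (isLTSeries_LTCoeff π) 1) (constantCoeff_hom _ _ _ 1)
      (evalPt₁ (maxNilIdeal F (E ⊔ ltField π n : IntermediateField F (AlgebraicClosure F)))
        (hom (isLTRing_LTCoeff hπ) (isLTSeries_LTCoeff π) (isLTSeries_LTCoeff π) (LTCoeff.of F a)) (constantCoeff_hom _ _ _ _)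
        (inclPt (le_sup_right : ltField π n ≤ E ⊔ ltField π n) (cohPt hπ n)))) =
      evalPt₁ (maxNilIdeal F (E' ⊔ ltField π n : IntermediateField F (AlgebraicClosure F)))
        (hom (isLTRing_LTCoeff hπ) hP' (isLTSeries_LTCoeff π) 1) (constantCoeff_hom _ _ _ 1)
        (evalPt₁ (maxNilIdeal F (E' ⊔ ltField π n : IntermediateField F (AlgebraicClosure F)))
          (hom (isLTRing_LTCoeff hπ) (isLTSeries_LTCoeff π) (isLTSeries_LTCoeff π) (LTCoeff.of F a)) (constantCoeff_hom _ _ _ _)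
          (inclPt (le_sup_right : ltField π n ≤ E' ⊔ ltField π n) (cohPt hπ n))) :=
    Subtype.ext (algHom_evalPt₁_hom (M := maxNilIdeal F (E ⊔ ltField π n : IntermediateField F (AlgebraicClosure F)))
      (M' := maxNilIdeal F (E' ⊔ ltField π n : IntermediateField F (AlgebraicClosure F)))
      (hA := isLTRing_LTCoeff hπ) (hf := hP') (hg := isLTSeries_LTCoeff π)
      (inclUnitBall (F := F) hn) (continuous_inclUnitBall _) 1 _ _ (congrArg Subtype.val h1))
  -- the `z`-coordinate of the included point is the included `z`-coordinate, which is the included parameter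
  have hz := zPt_some_eq_inclPt_zPt_some (E' ⊔ ltField π n : IntermediateField F (AlgebraicClosure F))
    (V.map ((LTCoeff.of F).toRingHom.comp e.symm.toRingHom)) hn hker hker' rfl rfl
  have ht := eq_zPt_of_ptOfZ_eq (E ⊔ ltField π n : IntermediateField F (AlgebraicClosure F))
    (V.map ((LTCoeff.of F).toRingHom.comp e.symm.toRingHom)) hker (ha n)
  rw [← h2, ht, ← hz]
  exact (eq_ptOfZ_zPt hker').symm

set_option maxHeartbeats 800000 in
/-- ★ **The Tate-module unit does not depend on the coefficient field**: if `a` serves the points `(X_n, Y_n)` over `E·K_π^{n+1}` and `b`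
serves `(X′_n, Y′_n)` over `E′·K_π^{n+1}` (`E ≤ E′`) with `ι X_n = X′_n`, `ι Y_n = Y′_n` (`ι` the inclusion; from equal `F̄`-coordinates
by `Subtype.ext`), then `a = b`.
[cite: deShalit1987, II §4.3 (p. 57), II §4.4 (iii)–(iv)] [cite: SilvermanAEC2009, VII.2.2] -/
theorem unit_eq_of_forall_ptOfZ_hom_hom_cohPt_eq_of_le
    [hEll : ∀ n : ℕ, (curveOver (E ⊔ ltField π n : IntermediateField F (AlgebraicClosure F))
      (V.map ((LTCoeff.of F).toRingHom.comp e.symm.toRingHom))).IsElliptic]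
    [hEll' : ∀ n : ℕ, (curveOver (E' ⊔ ltField π n : IntermediateField F (AlgebraicClosure F))
      (V.map ((LTCoeff.of F).toRingHom.comp e.symm.toRingHom))).IsElliptic]
    (hEE' : E ≤ E')
    (X Y : ∀ n : ℕ, ↥(E ⊔ ltField π n : IntermediateField F (AlgebraicClosure F)))
    (hXY : ∀ n : ℕ, (curveOver (E ⊔ ltField π n : IntermediateField F (AlgebraicClosure F))
      (V.map ((LTCoeff.of F).toRingHom.comp e.symm.toRingHom))).toAffine.Nonsingular (X n) (Y n))
    (X' Y' : ∀ n : ℕ, ↥(E' ⊔ ltField π n : IntermediateField F (AlgebraicClosure F)))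
    (hXY' : ∀ n : ℕ, (curveOver (E' ⊔ ltField π n : IntermediateField F (AlgebraicClosure F))
      (V.map ((LTCoeff.of F).toRingHom.comp e.symm.toRingHom))).toAffine.Nonsingular (X' n) (Y' n))
    (hx : ∀ n : ℕ, IntermediateField.inclusion (sup_le_sup_right hEE' (ltField π n)) (X n) = X' n)
    (hy : ∀ n : ℕ, IntermediateField.inclusion (sup_le_sup_right hEE' (ltField π n)) (Y n) = Y' n)
    {a b : 𝒪[F]ˣ}
    (ha : ∀ n : ℕ,
      ptOfZ (E ⊔ ltField π n : IntermediateField F (AlgebraicClosure F)) (V.map ((LTCoeff.of F).toRingHom.comp e.symm.toRingHom))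
        (evalPt₁ (maxNilIdeal F (E ⊔ ltField π n : IntermediateField F (AlgebraicClosure F)))
          (hom (isLTRing_LTCoeff hπ) (isLTSeries_map_LTCoeff_of_degree_one e hq he hP) (isLTSeries_LTCoeff π) 1)
          (constantCoeff_hom _ _ _ 1)
          (evalPt₁ (maxNilIdeal F (E ⊔ ltField π n : IntermediateField F (AlgebraicClosure F)))
            (hom (isLTRing_LTCoeff hπ) (isLTSeries_LTCoeff π) (isLTSeries_LTCoeff π) (LTCoeff.of F (a : 𝒪[F])))
            (constantCoeff_hom _ _ _ _)
            (inclPt (le_sup_right : ltField π n ≤ E ⊔ ltField π n) (cohPt hπ n)))) = .some (X n) (Y n) (hXY n))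
    (hb : ∀ n : ℕ,
      ptOfZ (E' ⊔ ltField π n : IntermediateField F (AlgebraicClosure F)) (V.map ((LTCoeff.of F).toRingHom.comp e.symm.toRingHom))
        (evalPt₁ (maxNilIdeal F (E' ⊔ ltField π n : IntermediateField F (AlgebraicClosure F)))
          (hom (isLTRing_LTCoeff hπ) (isLTSeries_map_LTCoeff_of_degree_one e hq he hP) (isLTSeries_LTCoeff π) 1)
          (constantCoeff_hom _ _ _ 1)
          (evalPt₁ (maxNilIdeal F (E' ⊔ ltField π n : IntermediateField F (AlgebraicClosure F)))
            (hom (isLTRing_LTCoeff hπ) (isLTSeries_LTCoeff π) (isLTSeries_LTCoeff π) (LTCoeff.of F (b : 𝒪[F])))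
            (constantCoeff_hom _ _ _ _)
            (inclPt (le_sup_right : ltField π n ≤ E' ⊔ ltField π n) (cohPt hπ n)))) = .some (X' n) (Y' n) (hXY' n)) :
    a = b := by
  refine unit_eq_of_forall_ptOfZ_hom_hom_cohPt_eq e hq hπ he hP V E' (fun n => .some (X' n) (Y' n) (hXY' n)) (fun n => ?_) hb
  exact forall_ptOfZ_hom_hom_cohPt_eq_of_le e hq hπ he hP V E E' hEE' X Y hXY ha n (X' n) (Y' n) (hx n) (hy n) (hXY' n)

end TateUnitEnlarge

end Literature.NumberTheory.EllipticCurves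

end
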